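import Literature.NumberTheory.LFunctions.LehmanCriticalLineBound
import Literature.NumberTheory.LFunctions.LehmanCriticalLineRun1
import Literature.NumberTheory.LFunctions.LehmanCriticalLineRun2
import Literature.NumberTheory.LFunctions.LehmanCriticalLineRun3
import Literature.NumberTheory.LFunctions.LehmanCriticalLineRun4
import Literature.NumberTheory.LFunctions.LehmanCriticalLineRun5
import Literature.NumberTheory.LFunctions.RiemannSiegelIntegralFormula
import Mathlib.Analysis.SpecialFunctions.Integrals.Basic
import Mathlib.Analysis.SpecialFunctions.ImproperIntegrals
import HarnessLib

/-!
# Trudgian's footnote to Lemma 2.5, certified: `|ζ(½ + it)| ≤ 2.53 t^{1/4}` for `1 ≤ t ≤ 404`,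
# and the reduction of `Trudgian2011_lemma_2_5_allT` to the printed Lemma 2.5

Topic `Literature/NumberTheory/LFunctions`. `LehmanCriticalLineBound.lean` vendors two named facts:
Lehman's bound `|ζ(½+it)| ≤ 2.53 t^{1/4}` for `t ≥ 128π` [Trudgian2011, Lemma 2.5] (explicit
remainder in the Riemann–Siegel formula, Titchmarsh 1935 / Lehman 1970), and its extension to all
`t > 1` asserted in the footnote to that lemma: "A computational check shows that Lemma 2.5 in
fact holds for all `t > 1`" (`Literature.NumberTheory.LFunctions.Trudgian2011_lemma_2_5_allT`).
Here the computational half is PROVED: the kernel-checked certificates of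
`LehmanCriticalLineRun1 … 5.lean` (format and soundness in `LehmanCriticalLineNumerics.lean`)
give the bound on `1 ≤ t ≤ 404 ⊃ (1, 128π]`, so that the footnote fact becomes *equivalent* to
the printed lemma; what remains of `Trudgian2011_lemma_2_5_allT` is exactly Lehman's
Riemann–Siegel estimate for `t ≥ 128π`.

## Part B: Lehman's bound for `t ≥ 128π` — discharge of both named facts

The analytic half is PROVED here as well (appended part, namespace
`Literature.NumberTheory.LFunctions.SiegelIntegral`): `theorem Trudgian2011_lemma_2_5_holds`
discharges the printed Lemma 2.5, and with Part A `theorem Trudgian2011_lemma_2_5_allT_holds`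
discharges the footnote fact. Lehman's argument (Lehman 1970, §3; Trudgian 2011, Lemma 2.5) bounds
`Z(t)` by the main sum `2Σ_{n≤√(t/2π)} n^{-1/2}` of the Riemann–Siegel formula plus an explicit
remainder. Here the remainder is controlled directly on Riemann's integral: by
`Literature.NumberTheory.LFunctions.SiegelIntegral.norm_riemannZeta_half_le_two_mul`
(`RiemannSiegelIntegralFormula.lean`), `|ζ(½+it)| ≤ 2|𝓡(s)|`; by the residue shift
`Literature.NumberTheory.LFunctions.SiegelIntegral.riemannAux_eq_sum_add_rsLineIntegral`,
`𝓡(s) = Σ_{n≤N} n^{-s} + J_c(s)` with `N = ⌊√(t/2π)⌋` and `c` the saddle abscissa `x₀ = √(t/2π)`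
clamped to `[N+¼, N+¾]`; and along the line of slope one through `c` the integrand is bounded by an
explicit Gaussian-type majorant (Titchmarsh §4.16 / Siegel §2 (14)–(15) in crude form:
`arctan y ≤ y` above the axis, `arctan z ≥ z/(1+z)` below it), giving `∫ ‖F‖ du ≤ ¾`
(`Literature.NumberTheory.LFunctions.SiegelIntegral.integral_norm_rsKernel_le`). With
`Σ_{n≤N} n^{-1/2} ≤ 2√N − 1.12` this yields `|ζ(½+it)| ≤ 4√N − 2.24 + 2.13 < 4(t/2π)^{1/4} ≤ 2.53 t^{1/4}`
(`Literature.NumberTheory.LFunctions.SiegelIntegral.norm_riemannZeta_half_le_lehman`).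

## Main results (namespace `Literature.NumberTheory.LFunctions`)

* `norm_riemannZeta_half_le_of_le_404` — `‖ζ(½+it)‖ ≤ 2.53 t^{1/4}` for `1 ≤ t ≤ 404` (proved).
* `Trudgian2011_lemma_2_5_smallT` — the same for `1 < t ≤ 128π` (the footnote's range).
* `Trudgian2011_lemma_2_5_allT_of_lemma_2_5`, `Trudgian2011_lemma_2_5_allT_iff` — the footnote
  fact follows from (indeed is equivalent to) the printed Lemma 2.5.
* `SiegelIntegral.norm_riemannZeta_half_le_lehman` — `‖ζ(½+it)‖ ≤ 2.53 t^{1/4}` for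
  `t ≥ 128π` (proved, Part B); `Trudgian2011_lemma_2_5_holds`, `Trudgian2011_lemma_2_5_allT_holds` —
  the discharges of the two named facts of `LehmanCriticalLineBound.lean`.

## References

* T. S. Trudgian, *Improvements to Turing's method*, Math. Comp. 80 (2011), 2259–2279, Lemma 2.5
  and its footnote. [Trudgian2011]
* D. J. Platt, T. S. Trudgian, *An improved explicit bound on `|ζ(½ + it)|`*, J. Number Theory
  147 (2015), 842–851, §1 and Lemma 4 (the same range verified by interval Euler–Maclaurin
  summation, step `1/1024`).
* R. S. Lehman, *On the distribution of zeros of the Riemann zeta-function*, Proc. LMS (3) 20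
  (1970), 303–320, §3. [Lehman1970]
* E. C. Titchmarsh, *The Theory of the Riemann Zeta-Function*, 2nd ed. (1986), §4.16. [Titchmarsh1986]
* C. L. Siegel, *Über Riemanns Nachlaß zur analytischen Zahlentheorie* (1932), §2 (14)–(15).
  [Siegel1932]
-/

noncomputable section

open Complex Real

namespace Literature.NumberTheory.LFunctions

/-- **`|ζ(½ + it)| ≤ 2.53 t^{1/4}` for `1 ≤ t ≤ 404`**, from the five certified runs
`CritLineCert.norm_riemannZeta_half_le_run1 … 5` (chunks `[1, b₁]`, `[b₁, b₂]`, …, `[b₄, 404]`).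
[cite: Trudgian2011, Lemma 2.5 (footnote)] -/
theorem norm_riemannZeta_half_le_of_le_404 (t : ℝ) (h₁ : 1 ≤ t) (h₂ : t ≤ 404) :
    ‖riemannZeta (1 / 2 + t * I)‖ ≤ 2.53 * t ^ (1 / 4 : ℝ) := by
  rcases le_or_gt t (5066 / 25) with ha | ha
  · exact CritLineCert.norm_riemannZeta_half_le_run1 t h₁ ha
  rcases le_or_gt t (5711 / 20) with hb | hb
  · exact CritLineCert.norm_riemannZeta_half_le_run2 t ha.le hb
  rcases le_or_gt t (17499 / 50) with hc | hc
  · exact CritLineCert.norm_riemannZeta_half_le_run3 t hb.le hc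
  rcases le_or_gt t (39189 / 100) with hd | hd
  · exact CritLineCert.norm_riemannZeta_half_le_run4 t hc.le hd
  · exact CritLineCert.norm_riemannZeta_half_le_run5 t hd.le h₂

/-- **Trudgian's footnote, the computational range**: `|ζ(½ + it)| ≤ 2.53 t^{1/4}` for
`1 < t ≤ 128π` (`128π < 404`). [cite: Trudgian2011, Lemma 2.5 (footnote)] -/
theorem Trudgian2011_lemma_2_5_smallT (t : ℝ) (h₁ : 1 < t) (h₂ : t ≤ 128 * π) :
    ‖riemannZeta (1 / 2 + t * I)‖ ≤ 2.53 * t ^ (1 / 4 : ℝ) :=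
  norm_riemannZeta_half_le_of_le_404 t h₁.le (h₂.trans (by nlinarith [Real.pi_lt_d2]))

/-- **The footnote fact follows from the printed Lemma 2.5** (Lehman's Riemann–Siegel bound for
`t ≥ 128π`): the range `1 < t < 128π` is covered by the certified computation.
[cite: Trudgian2011, Lemma 2.5 (footnote)] -/
theorem Trudgian2011_lemma_2_5_allT_of_lemma_2_5 (h : Trudgian2011_lemma_2_5) :
    Trudgian2011_lemma_2_5_allT := fun t ht ↦ by
  rcases le_or_gt t (128 * π) with hle | hgt
  · exact Trudgian2011_lemma_2_5_smallT t ht hle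
  · exact h t hgt.le

/-- The footnote fact and the printed Lemma 2.5 are equivalent. [cite: Trudgian2011, Lemma 2.5] -/
theorem Trudgian2011_lemma_2_5_allT_iff : Trudgian2011_lemma_2_5_allT ↔ Trudgian2011_lemma_2_5 :=
  ⟨Trudgian2011_lemma_2_5_allT.lemma_2_5, Trudgian2011_lemma_2_5_allT_of_lemma_2_5⟩

/-! ## Part B: Lehman's bound `|ζ(½+it)| ≤ 2.53 t^{1/4}` for `t ≥ 128π` via the Riemann–Siegel integral -/

open MeasureTheory Set Filter
open scoped Topology ComplexConjugate

namespace SiegelIntegral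

/-! ## Lehman's bound `|ζ(½+it)| ≤ 4(t/2π)^{1/4}`: the saddle-point estimate (Siegel 1932, §2 (14)–(15)) -/

/-! ### Elementary inequalities -/

/-- `z/(1+z) ≤ arctan z` for `z ≥ 0` (`arctan z = ∫₀^z dt/(1+t²) ≥ ∫₀^z dt/(1+t)²`). [folklore] -/
lemma div_one_add_self_le_arctan {z : ℝ} (hz : 0 ≤ z) : z / (1 + z) ≤ Real.arctan z := by
  have h1 : ∫ t in (0 : ℝ)..z, (1 : ℝ) / (1 + t ^ 2) = Real.arctan z := by
    rw [integral_one_div_one_add_sq, Real.arctan_zero, sub_zero]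
  have hderiv : ∀ t ∈ Set.uIcc 0 z, HasDerivAt (fun t : ℝ ↦ -(1 + t)⁻¹) (1 / (1 + t) ^ 2) t := by
    intro t ht
    rw [Set.uIcc_of_le hz] at ht
    have h0 : (1 + t) ≠ 0 := by linarith [ht.1]
    exact (((hasDerivAt_id' t).const_add 1).inv h0).neg.congr_deriv (by rw [neg_div, neg_neg])
  have hcont : ContinuousOn (fun t : ℝ ↦ (1 : ℝ) / (1 + t) ^ 2) (Set.uIcc 0 z) := by
    refine ContinuousOn.div continuousOn_const (by fun_prop) fun t ht ↦ ?_
    rw [Set.uIcc_of_le hz] at ht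
    have : 0 < 1 + t := by linarith [ht.1]
    positivity
  have h2 : ∫ t in (0 : ℝ)..z, (1 : ℝ) / (1 + t) ^ 2 = z / (1 + z) := by
    rw [intervalIntegral.integral_eq_sub_of_hasDerivAt hderiv (hcont.intervalIntegrable)]
    have : (1 + z) ≠ 0 := by linarith
    field_simp
    ring
  rw [← h1, ← h2]
  refine intervalIntegral.integral_mono_on hz hcont.intervalIntegrable ?_ fun t ht ↦ ?_
  · exact (continuous_const.div (by fun_prop) (fun t ↦ by positivity) :
      Continuous fun t : ℝ ↦ (1 : ℝ) / (1 + t ^ 2)).intervalIntegrable _ _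
  · apply one_div_le_one_div_of_le (by positivity)
    nlinarith [ht.1]

/-- The argument of a point of the line through `c` with positive real part:
`arg(c + u(1+i)) = arctan(u/(c+u))`. [folklore] -/
lemma arg_line_eq_arctan {c u : ℝ} (h : 0 < c + u) : (line c u).arg = Real.arctan (u / (c + u)) := by
  have hre : 0 < (line c u).re := by rw [line_re]; exact h
  have h1 : |(line c u).arg| < π / 2 := Complex.abs_arg_lt_pi_div_two_iff.2 (Or.inl hre)
  have h2 := Complex.tan_arg (line c u)
  rw [line_re, line_im] at h2
  rw [← h2, Real.arctan_tan (abs_lt.1 h1).1 (abs_lt.1 h1).2]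

/-- **The exponent along the saddle line** (the real-variable heart of Titchmarsh §4.16 / Siegel's
(14)–(15)): for `x₀ ≥ 8`, `|c − x₀| ≤ ¼` and `c + u > 0`,
`2πx₀²·arctan(u/(c+u)) − 2πcu − 2πu² ≤ −2πu² + (πu/2 + 1/5)` if `u ≥ 0`, resp. `+ π|u|` if `u < 0`
(`arctan y ≤ y` above the axis, `arctan z ≥ z/(1+z)` below it). [cite: Titchmarsh1986, §4.16] -/
lemma saddle_exponent_le {x₀ c u : ℝ} (hx₀ : 8 ≤ x₀) (hδ : |c - x₀| ≤ 1 / 4) (hw : 0 < c + u) :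
    2 * π * x₀ ^ 2 * Real.arctan (u / (c + u)) - 2 * π * c * u - 2 * π * u ^ 2 ≤
      -2 * π * u ^ 2 + (if 0 ≤ u then π / 2 * u + 1 / 5 else -(π * u)) := by
  have hπ := Real.pi_pos
  have hπ4 : π < 3.1416 := Real.pi_lt_d4
  obtain ⟨hδ1, hδ2⟩ := abs_le.1 hδ
  have hc : 7.75 ≤ c := by linarith
  rcases le_or_gt 0 u with hu | hu
  · rw [if_pos hu]
    have hA : Real.arctan (u / (c + u)) ≤ u / (c + u) := by
      -- `arctan y ≤ y` for `y ≥ 0` (folklore; cf. `Literature.NumberTheory.LFunctions.arctan_le_self`)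
      have h := Real.le_tan (Real.arctan_nonneg.2 (div_nonneg hu hw.le))
        (Real.arctan_lt_pi_div_two _)
      rwa [Real.tan_arctan] at h
    have h1 : 2 * π * x₀ ^ 2 * Real.arctan (u / (c + u)) ≤ 2 * π * x₀ ^ 2 * (u / (c + u)) :=
      mul_le_mul_of_nonneg_left hA (by positivity)
    have key : 2 * π * x₀ ^ 2 * (u / (c + u)) - 2 * π * c * u - 2 * π * u ^ 2 =
        -(2 * π * u * (u + (c - x₀))) * ((x₀ + (c + u)) / (c + u)) := by
      field_simp
      ring
    suffices hs : 2 * π * x₀ ^ 2 * (u / (c + u)) - 2 * π * c * u - 2 * π * u ^ 2 ≤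
        -2 * π * u ^ 2 + (π / 2 * u + 1 / 5) by linarith
    rw [key]
    have hρ1 : 1 ≤ (x₀ + (c + u)) / (c + u) := by
      rw [le_div_iff₀ hw]; linarith
    have hρ2 : (x₀ + (c + u)) / (c + u) ≤ 63 / 31 := by
      rw [div_le_iff₀ hw]; nlinarith
    rcases le_or_gt 0 (u + (c - x₀)) with hud | hud
    · -- `u + δ ≥ 0`: the term is `≤ -2πu(u+δ) ≤ -2πu² + (π/2)u`
      have hK : 0 ≤ 2 * π * u * (u + (c - x₀)) := by positivity
      have hprod : 0 ≤ π * u * (c - x₀ + 1 / 4) := mul_nonneg (mul_nonneg hπ.le hu) (by linarith)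
      calc -(2 * π * u * (u + (c - x₀))) * ((x₀ + (c + u)) / (c + u))
          ≤ -(2 * π * u * (u + (c - x₀))) * 1 := by nlinarith
        _ ≤ -2 * π * u ^ 2 + (π / 2 * u + 1 / 5) := by nlinarith
    · -- `u + δ < 0`: `0 ≤ u < 1/4`, the term is `≤ 2π·(1/64)·(63/31) < 1/5`
      have hu4 : u < 1 / 4 := by linarith
      have hprod : u * (-(u + (c - x₀))) ≤ 1 / 64 := by nlinarith [sq_nonneg (2 * u + (c - x₀))]
      have hpos : 0 ≤ u * (-(u + (c - x₀))) := mul_nonneg hu (by linarith)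
      have h3 : -(2 * π * u * (u + (c - x₀))) * ((x₀ + (c + u)) / (c + u)) ≤ 1 / 5 := by
        have e : -(2 * π * u * (u + (c - x₀))) = 2 * π * (u * (-(u + (c - x₀)))) := by ring
        rw [e]
        calc 2 * π * (u * -(u + (c - x₀))) * ((x₀ + (c + u)) / (c + u))
            ≤ 2 * π * (1 / 64) * (63 / 31) := by
              apply mul_le_mul (by nlinarith) hρ2 (by positivity) (by positivity)
          _ ≤ 1 / 5 := by nlinarith
      have h4 : 0 ≤ -2 * π * u ^ 2 + π / 2 * u := by
        have := mul_nonneg (mul_nonneg hπ.le hu) (by linarith : (0 : ℝ) ≤ 1 / 4 - u)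
        nlinarith
      linarith
  · rw [if_neg (not_le.2 hu)]
    -- `u < 0`: `arctan(u/(c+u)) = -arctan(b/(c-b)) ≤ -b/c`, `b = -u`
    have hb : 0 < -u := by linarith
    have hz : 0 ≤ -u / (c + u) := div_nonneg hb.le hw.le
    have hA : (-u / (c + u)) / (1 + -u / (c + u)) ≤ Real.arctan (-u / (c + u)) :=
      div_one_add_self_le_arctan hz
    have hcpos : 0 < c := by linarith
    have hsimp : (-u / (c + u)) / (1 + -u / (c + u)) = -u / c := by
      field_simp
      ring
    rw [hsimp] at hA
    have hA' : Real.arctan (u / (c + u)) ≤ u / c := by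
      rw [neg_div, neg_div, Real.arctan_neg] at hA
      linarith
    have h1 : 2 * π * x₀ ^ 2 * Real.arctan (u / (c + u)) ≤ 2 * π * x₀ ^ 2 * (u / c) :=
      mul_le_mul_of_nonneg_left hA' (by positivity)
    suffices hs : 2 * π * x₀ ^ 2 * (u / c) - 2 * π * c * u - 2 * π * u ^ 2 ≤
        -2 * π * u ^ 2 + -(π * u) by linarith
    have key : 2 * π * x₀ ^ 2 * (u / c) - 2 * π * c * u - 2 * π * u ^ 2 =
        -2 * π * u ^ 2 + 2 * π * (-u) * ((c ^ 2 - x₀ ^ 2) / c) := by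
      field_simp
      ring
    rw [key]
    -- `(c² - x₀²)/c ≤ 1/2`
    have hq : (c ^ 2 - x₀ ^ 2) / c ≤ 1 / 2 := by
      rw [div_le_iff₀ hcpos]
      rcases le_or_gt (c - x₀) 0 with hd | hd
      · nlinarith
      · nlinarith
    have := mul_le_mul_of_nonneg_left hq (by positivity : 0 ≤ 2 * π * (-u))
    nlinarith

/-! ### The modulus of Siegel's integrand on the critical line -/

/-- For `s = ½ + it` and `x = c + u(1+i)` (`c > 0`):
`‖F_s(x)‖ = ‖x‖^{-1/2} e^{t·arg x − 2πcu − 2πu²}/(2‖sin πx‖)`. [folklore] -/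
lemma norm_rsKernel_half_line {c : ℝ} (hc : 0 < c) (t u : ℝ) :
    ‖rsKernel (1 / 2 + t * I) (line c u)‖ =
      ‖line c u‖ ^ (-(1 / 2 : ℝ)) * Real.exp (t * (line c u).arg + (-2 * π * c * u - 2 * π * u ^ 2)) /
        (2 * ‖Complex.sin (π * line c u)‖) := by
  have hx : line c u ≠ 0 := line_ne_zero hc.ne' u
  rw [rsKernel, norm_div, norm_mul, norm_mul, norm_mul, Complex.norm_two, Complex.norm_I, mul_one,
    norm_cpow_neg hx]
  have h2 : ‖cexp (π * I * (line c u) ^ 2)‖ = Real.exp (-2 * π * c * u - 2 * π * u ^ 2) := by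
    have := norm_cexp_quadPhase 0 c u
    simp only [zero_mul, add_zero, zero_re, zero_im, sub_zero] at this
    rw [this]; congr 1; ring
  rw [h2]
  simp only [add_re, one_div, inv_re, re_ofNat, normSq_ofNat, mul_re, ofReal_re, I_re, mul_zero,
    ofReal_im, I_im, mul_one, sub_self, add_zero, add_im, inv_im, im_ofNat, neg_zero, zero_div,
    mul_im, zero_add]
  rw [Real.exp_add]
  norm_num
  ring

/-- The exponent is controlled everywhere on the line: with `t = 2πx₀²`, `x₀ ≥ 8`, `|c − x₀| ≤ ¼`,
`t·arg x − 2πcu − 2πu² ≤ B(u)` where `B(u) = −2πu² + πu/2 + 1/5` (`u ≥ 0`), `−2πu² + π|u|`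
(`−c < u < 0`), `0` (`u ≤ −c`). [cite: Titchmarsh1986, §4.16] -/
lemma exponent_le {x₀ c u : ℝ} (hx₀ : 8 ≤ x₀) (hδ : |c - x₀| ≤ 1 / 4) :
    2 * π * x₀ ^ 2 * (line c u).arg + (-2 * π * c * u - 2 * π * u ^ 2) ≤
      if 0 ≤ u then -2 * π * u ^ 2 + π / 2 * u + 1 / 5
      else if -c < u then -2 * π * u ^ 2 + -(π * u) else 0 := by
  have hπ := Real.pi_pos
  obtain ⟨hδ1, hδ2⟩ := abs_le.1 hδ
  have hc : 7.75 ≤ c := by linarith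
  by_cases hw : 0 < c + u
  · rw [arg_line_eq_arctan hw]
    have h := saddle_exponent_le hx₀ hδ hw
    by_cases hu : 0 ≤ u
    · rw [if_pos hu] at h ⊢; linarith
    · rw [if_neg hu] at h ⊢; rw [if_pos (by linarith)]; linarith
  · have hw' : c + u ≤ 0 := not_lt.1 hw
    have hu : ¬ 0 ≤ u := by intro h; linarith
    rw [if_neg hu, if_neg (by linarith)]
    have harg : (line c u).arg < 0 := Complex.arg_neg_iff.2 (by rw [line_im]; linarith)
    have h1 : 2 * π * x₀ ^ 2 * (line c u).arg ≤ 0 :=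
      mul_nonpos_of_nonneg_of_nonpos (by positivity) harg.le
    have h2 : 0 ≤ π * (u * (c + u)) :=
      mul_nonneg hπ.le (mul_nonneg_of_nonpos_of_nonpos (by linarith) hw')
    nlinarith

/-! ### The denominator and the power on the three ranges -/

/-- Core range `|u| ≤ ¼`, `dist(c, ℤ) ≥ ¼`: `‖sin(πx)‖ ≥ 21/50`
(`‖sin‖² ≥ (½ − 2|u|)² + π²u² ≥ 0.1764`). [folklore] -/
lemma norm_sin_core {c u : ℝ} (hd : ∀ n : ℤ, (1 : ℝ) / 4 ≤ |c - n|) (hu : |u| ≤ 1 / 4) :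
    (21 : ℝ) / 50 ≤ ‖Complex.sin (π * line c u)‖ := by
  have hπ3 : 3.1415 < π := Real.pi_gt_d4
  have hsq : ‖Complex.sin (π * line c u)‖ ^ 2 = Real.sin (π * (c + u)) ^ 2 + Real.sinh (π * u) ^ 2 := by
    rw [show (π : ℂ) * line c u = ((π * (c + u) : ℝ) : ℂ) + ((π * u : ℝ) : ℂ) * I by
      rw [line_eq]; push_cast; ring]
    exact sq_norm_sin_ofReal_add_mul_I _ _
  -- the `sin` term: `|sin π(c+u)| ≥ 2(1/4 - |u|)`
  set m : ℤ := round (c + u)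
  have h1 : 2 * |c + u - m| ≤ |Real.sin (π * (c + u))| := two_mul_abs_sub_round_le_abs_sin _
  have h2 : (1 : ℝ) / 4 - |u| ≤ |c + u - m| := by
    have := hd m
    have h3 : |c - m| ≤ |c + u - m| + |u| := by
      have := abs_add_le (c + u - m) (-u)
      rw [show c + u - ↑m + -u = c - m by ring, abs_neg] at this
      exact this
    linarith
  have hsin : 2 * ((1 : ℝ) / 4 - |u|) ≤ |Real.sin (π * (c + u))| := by linarith
  have hsin0 : 0 ≤ 2 * ((1 : ℝ) / 4 - |u|) := by linarith
  have hsin2 : (2 * ((1 : ℝ) / 4 - |u|)) ^ 2 ≤ Real.sin (π * (c + u)) ^ 2 := by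
    have := pow_le_pow_left₀ hsin0 hsin 2
    rwa [sq_abs] at this
  -- the `sinh` term: `sinh²(πu) ≥ π²u²`
  have hsinh : π * |u| ≤ |Real.sinh (π * u)| := by
    rw [Real.abs_sinh, ← abs_of_pos Real.pi_pos, ← abs_mul, abs_of_pos Real.pi_pos]
    exact Real.self_le_sinh_iff.2 (by positivity)
  have hsinh2 : (π * |u|) ^ 2 ≤ Real.sinh (π * u) ^ 2 := by
    have := pow_le_pow_left₀ (by positivity) hsinh 2
    rwa [sq_abs] at this
  have key : ((21 : ℝ) / 50) ^ 2 ≤ ‖Complex.sin (π * line c u)‖ ^ 2 := by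
    rw [hsq]
    have hu0 := abs_nonneg u
    have hππ : 9.869 ≤ π ^ 2 := by nlinarith
    have e1 : 9.869 * |u| ^ 2 ≤ (π * |u|) ^ 2 := by
      rw [mul_pow]; exact mul_le_mul_of_nonneg_right hππ (sq_nonneg _)
    have e2 : ((21 : ℝ) / 50) ^ 2 ≤ (2 * (1 / 4 - |u|)) ^ 2 + 9.869 * |u| ^ 2 := by
      nlinarith [sq_nonneg (|u| - 721 / 10000)]
    linarith
  have h := Real.sqrt_le_sqrt key
  rwa [Real.sqrt_sq (by norm_num), Real.sqrt_sq (norm_nonneg _)] at h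

/-- Middle and tail ranges: `‖sin(πx)‖ ≥ |sinh(πu)| ≥ π|u|`. [folklore] -/
lemma pi_mul_abs_le_norm_sin (c u : ℝ) : π * |u| ≤ ‖Complex.sin (π * line c u)‖ := by
  have hsq : ‖Complex.sin (π * line c u)‖ ^ 2 = Real.sin (π * (c + u)) ^ 2 + Real.sinh (π * u) ^ 2 := by
    rw [show (π : ℂ) * line c u = ((π * (c + u) : ℝ) : ℂ) + ((π * u : ℝ) : ℂ) * I by
      rw [line_eq]; push_cast; ring]
    exact sq_norm_sin_ofReal_add_mul_I _ _
  have hsinh : π * |u| ≤ |Real.sinh (π * u)| := by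
    rw [Real.abs_sinh, ← abs_of_pos Real.pi_pos, ← abs_mul, abs_of_pos Real.pi_pos]
    exact Real.self_le_sinh_iff.2 (by positivity)
  have key : (π * |u|) ^ 2 ≤ ‖Complex.sin (π * line c u)‖ ^ 2 := by
    have := pow_le_pow_left₀ (by positivity) hsinh 2
    rw [sq_abs] at this
    rw [hsq]; nlinarith [sq_nonneg (Real.sin (π * (c + u)))]
  have h := Real.sqrt_le_sqrt key
  rwa [Real.sqrt_sq (by positivity), Real.sqrt_sq (norm_nonneg _)] at h

/-- Tail range: `‖sin(πx)‖ ≥ |sinh(πu)| ≥ e^{π|u|}/4` for `|u| ≥ ½` (`sinh y ≥ e^y/4` for `y ≥ 1`).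
[folklore] -/
lemma exp_le_norm_sin_tail (c : ℝ) {u : ℝ} (hu : (1 : ℝ) / 2 ≤ |u|) :
    Real.exp (π * |u|) / 4 ≤ ‖Complex.sin (π * line c u)‖ := by
  have hπ3 : 3.1415 < π := Real.pi_gt_d4
  have hsq : ‖Complex.sin (π * line c u)‖ ^ 2 = Real.sin (π * (c + u)) ^ 2 + Real.sinh (π * u) ^ 2 := by
    rw [show (π : ℂ) * line c u = ((π * (c + u) : ℝ) : ℂ) + ((π * u : ℝ) : ℂ) * I by
      rw [line_eq]; push_cast; ring]
    exact sq_norm_sin_ofReal_add_mul_I _ _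
  -- `sinh y ≥ e^y/4` for `y = π|u| ≥ 1`
  set y : ℝ := π * |u| with hy
  have hy1 : 1 ≤ y := by rw [hy]; nlinarith
  have hsinh : Real.exp y / 4 ≤ Real.sinh y := by
    rw [Real.sinh_eq]
    have h1 : Real.exp (-y) ≤ Real.exp y / 2 := by
      have h2 : Real.exp (-y) * Real.exp (-y) ≤ 1 / 2 * 1 := by
        rw [← Real.exp_add]
        have : Real.exp (-y + -y) ≤ Real.exp (-1) := Real.exp_le_exp.2 (by linarith)
        have h3 : Real.exp (-1) ≤ 1 / 2 := by
          rw [Real.exp_neg, inv_le_comm₀ (Real.exp_pos _) (by norm_num)]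
          have := Real.add_one_le_exp (1 : ℝ)
          linarith
        linarith
      have h4 : Real.exp (-y) * Real.exp y = 1 := by rw [← Real.exp_add, neg_add_cancel, Real.exp_zero]
      nlinarith [Real.exp_pos y, Real.exp_pos (-y)]
    linarith
  have habs : Real.sinh y = |Real.sinh (π * u)| := by rw [Real.abs_sinh, abs_mul, abs_of_pos Real.pi_pos]
  have key : (Real.exp y / 4) ^ 2 ≤ ‖Complex.sin (π * line c u)‖ ^ 2 := by
    have h1 : (Real.exp y / 4) ^ 2 ≤ Real.sinh y ^ 2 := pow_le_pow_left₀ (by positivity) hsinh 2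
    rw [habs, sq_abs] at h1
    rw [hsq]; nlinarith [sq_nonneg (Real.sin (π * (c + u)))]
  have h := Real.sqrt_le_sqrt key
  rwa [Real.sqrt_sq (by positivity), Real.sqrt_sq (norm_nonneg _)] at h

/-- `‖x‖^{-1/2} ≤ a` as soon as `‖x‖ ≥ b > 0` and `1 ≤ a² b`. [folklore] -/
lemma rpow_neg_half_le {r a b : ℝ} (hb : 0 < b) (ha : 0 < a) (hab : 1 ≤ a ^ 2 * b) (hr : b ≤ r) :
    r ^ (-(1 / 2 : ℝ)) ≤ a := by
  have h1 : r ^ (-(1 / 2 : ℝ)) ≤ b ^ (-(1 / 2 : ℝ)) :=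
    Real.rpow_le_rpow_of_nonpos hb hr (by norm_num)
  have hsb : 0 < Real.sqrt b := Real.sqrt_pos.2 hb
  have h2 : 1 ≤ a * Real.sqrt b := by
    have h3 : 1 ≤ (a * Real.sqrt b) ^ 2 := by rw [mul_pow, Real.sq_sqrt hb.le]; exact hab
    nlinarith [mul_pos ha hsb]
  calc r ^ (-(1 / 2 : ℝ)) ≤ b ^ (-(1 / 2 : ℝ)) := h1
    _ = (Real.sqrt b)⁻¹ := by rw [Real.rpow_neg hb.le, ← Real.sqrt_eq_rpow]
    _ ≤ a := by rw [inv_eq_one_div, div_le_iff₀ hsb]; exact h2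

/-- `e^{2/5} ≤ 3/2` and `e^{1/5} ≤ 11/9`. [folklore] -/
lemma exp_two_fifths_le : Real.exp (2 / 5) ≤ 3 / 2 ∧ Real.exp (1 / 5) ≤ 11 / 9 := by
  constructor
  · have h := Real.exp_bound (x := 2 / 5) (by norm_num [abs_of_pos]) (n := 3) (by norm_num)
    simp only [Finset.sum_range_succ, Finset.sum_range_zero, Nat.factorial] at h
    norm_num [abs_of_pos] at h
    have := (abs_le.1 h).2
    linarith
  · have h := Real.exp_bound (x := 1 / 5) (by norm_num [abs_of_pos]) (n := 3) (by norm_num)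
    simp only [Finset.sum_range_succ, Finset.sum_range_zero, Nat.factorial] at h
    norm_num [abs_of_pos] at h
    have := (abs_le.1 h).2
    linarith


/-! ### The three ranges: pointwise bounds -/

/-- Bounds on the saddle exponent on the three ranges (from `exponent_le`):
`≤ 2/5` for `|u| ≤ ½`, and `≤ 1/5` for `|u| ≥ ½`... precisely as needed below. [folklore] -/
lemma exponent_le_two_fifths {x₀ c u : ℝ} (hx₀ : 8 ≤ x₀) (hδ : |c - x₀| ≤ 1 / 4) (hu : |u| ≤ 1 / 2) :
    2 * π * x₀ ^ 2 * (line c u).arg + (-2 * π * c * u - 2 * π * u ^ 2) ≤ 2 / 5 := by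
  have h := exponent_le (u := u) hx₀ hδ
  have hπ := Real.pi_pos
  have hπ4 : π < 3.1416 := Real.pi_lt_d4
  obtain ⟨hu1, hu2⟩ := abs_le.1 hu
  by_cases h0 : 0 ≤ u
  · rw [if_pos h0] at h
    have : -2 * π * u ^ 2 + π / 2 * u ≤ π / 32 := by nlinarith [sq_nonneg (u - 1 / 8)]
    linarith
  · rw [if_neg h0] at h
    by_cases h1 : -c < u
    · rw [if_pos h1] at h
      have : -2 * π * u ^ 2 + -(π * u) ≤ π / 8 := by nlinarith [sq_nonneg (u + 1 / 4)]
      linarith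
    · rw [if_neg h1] at h; linarith

/-- For `|u| ≥ ½` the exponent is `≤ 1/5`. [folklore] -/
lemma exponent_le_one_fifth {x₀ c u : ℝ} (hx₀ : 8 ≤ x₀) (hδ : |c - x₀| ≤ 1 / 4) (hu : (1 : ℝ) / 2 ≤ |u|) :
    2 * π * x₀ ^ 2 * (line c u).arg + (-2 * π * c * u - 2 * π * u ^ 2) ≤ 1 / 5 := by
  have h := exponent_le (u := u) hx₀ hδ
  have hπ := Real.pi_pos
  by_cases h0 : 0 ≤ u
  · rw [if_pos h0] at h
    rw [abs_of_nonneg h0] at hu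
    have : -2 * π * u ^ 2 + π / 2 * u ≤ 0 := by
      have := mul_nonneg (mul_nonneg hπ.le h0) (by linarith : (0 : ℝ) ≤ 2 * u - 1 / 2)
      nlinarith
    linarith
  · rw [if_neg h0] at h
    rw [abs_of_neg (not_le.1 h0)] at hu
    by_cases h1 : -c < u
    · rw [if_pos h1] at h
      have : -2 * π * u ^ 2 + -(π * u) ≤ 0 := by
        have := mul_nonneg (mul_nonneg hπ.le (by linarith : (0 : ℝ) ≤ -u)) (by linarith : (0 : ℝ) ≤ -(2 * u + 1))
        nlinarith
      linarith
    · rw [if_neg h1] at h; linarith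

/-- **Core range** `|u| ≤ ¼`: `‖F(x)‖ ≤ 33/50` (`‖x‖ ≥ 7.5`, exponent `≤ 2/5`, `‖sin‖ ≥ 21/50`).
[cite: Titchmarsh1986, §4.16] -/
lemma norm_rsKernel_core {x₀ c u t : ℝ} (ht : t = 2 * π * x₀ ^ 2) (hx₀ : 8 ≤ x₀) (hδ : |c - x₀| ≤ 1 / 4)
    (hd : ∀ n : ℤ, (1 : ℝ) / 4 ≤ |c - n|) (hu : |u| ≤ 1 / 4) :
    ‖rsKernel (1 / 2 + t * I) (line c u)‖ ≤ 33 / 50 := by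
  obtain ⟨hδ1, hδ2⟩ := abs_le.1 hδ
  obtain ⟨hu1, hu2⟩ := abs_le.1 hu
  have hc : 7.75 ≤ c := by linarith
  have hc0 : 0 < c := by linarith
  rw [norm_rsKernel_half_line hc0, ht]
  have hA : ‖line c u‖ ^ (-(1 / 2 : ℝ)) ≤ 0.366 := by
    refine rpow_neg_half_le (b := 7.5) (by norm_num) (by norm_num) (by norm_num) ?_
    exact le_trans (by rw [line_re]; linarith) (Complex.re_le_norm _)
  have hE : Real.exp (2 * π * x₀ ^ 2 * (line c u).arg + (-2 * π * c * u - 2 * π * u ^ 2)) ≤ 3 / 2 :=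
    (Real.exp_le_exp.2 (exponent_le_two_fifths hx₀ hδ (by linarith))).trans exp_two_fifths_le.1
  have hS := norm_sin_core hd hu
  have hnum : ‖line c u‖ ^ (-(1 / 2 : ℝ)) *
      Real.exp (2 * π * x₀ ^ 2 * (line c u).arg + (-2 * π * c * u - 2 * π * u ^ 2)) ≤ 0.366 * (3 / 2) :=
    mul_le_mul hA hE (Real.exp_pos _).le (by norm_num)
  calc _ ≤ 0.366 * (3 / 2) / (2 * ‖Complex.sin (↑π * line c u)‖) :=
        div_le_div_of_nonneg_right hnum (by positivity)
    _ ≤ 0.366 * (3 / 2) / (2 * (21 / 50)) :=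
        div_le_div_of_nonneg_left (by norm_num) (by norm_num) (by linarith)
    _ ≤ 33 / 50 := by norm_num

/-- **Middle range** `¼ ≤ |u| ≤ ½`: `‖F(x)‖ ≤ 37/100` (`‖x‖ ≥ 7.25`, exponent `≤ 2/5`,
`‖sin‖ ≥ π|u| > π/4`). [cite: Titchmarsh1986, §4.16] -/
lemma norm_rsKernel_mid {x₀ c u t : ℝ} (ht : t = 2 * π * x₀ ^ 2) (hx₀ : 8 ≤ x₀) (hδ : |c - x₀| ≤ 1 / 4)
    (hu1 : (1 : ℝ) / 4 ≤ |u|) (hu2 : |u| ≤ 1 / 2) :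
    ‖rsKernel (1 / 2 + t * I) (line c u)‖ ≤ 37 / 100 := by
  have hπ3 : 3.1415 < π := Real.pi_gt_d4
  obtain ⟨hδ1, hδ2⟩ := abs_le.1 hδ
  obtain ⟨hu3, hu4⟩ := abs_le.1 hu2
  have hc : 7.75 ≤ c := by linarith
  have hc0 : 0 < c := by linarith
  rw [norm_rsKernel_half_line hc0, ht]
  have hA : ‖line c u‖ ^ (-(1 / 2 : ℝ)) ≤ 0.372 := by
    refine rpow_neg_half_le (b := 7.25) (by norm_num) (by norm_num) (by norm_num) ?_
    exact le_trans (by rw [line_re]; linarith) (Complex.re_le_norm _)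
  have hE : Real.exp (2 * π * x₀ ^ 2 * (line c u).arg + (-2 * π * c * u - 2 * π * u ^ 2)) ≤ 3 / 2 :=
    (Real.exp_le_exp.2 (exponent_le_two_fifths hx₀ hδ hu2)).trans exp_two_fifths_le.1
  have hS : π / 4 ≤ ‖Complex.sin (π * line c u)‖ := by
    have := pi_mul_abs_le_norm_sin c u
    nlinarith [Real.pi_pos]
  have hnum : ‖line c u‖ ^ (-(1 / 2 : ℝ)) *
      Real.exp (2 * π * x₀ ^ 2 * (line c u).arg + (-2 * π * c * u - 2 * π * u ^ 2)) ≤ 0.372 * (3 / 2) :=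
    mul_le_mul hA hE (Real.exp_pos _).le (by norm_num)
  calc _ ≤ 0.372 * (3 / 2) / (2 * ‖Complex.sin (↑π * line c u)‖) :=
        div_le_div_of_nonneg_right hnum (by positivity)
    _ ≤ 0.372 * (3 / 2) / (2 * (π / 4)) :=
        div_le_div_of_nonneg_left (by norm_num) (by positivity) (by linarith)
    _ ≤ 37 / 100 := by
        rw [div_le_iff₀ (by positivity)]; nlinarith

/-- **Tail range** `|u| > ½`: `‖F(x)‖ ≤ (21/20) e^{−π|u|}` (`‖x‖ ≥ √30`, exponent `≤ 1/5`,
`‖sin‖ ≥ e^{π|u|}/4`). [cite: Titchmarsh1986, §4.16] -/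
lemma norm_rsKernel_tail {x₀ c u t : ℝ} (ht : t = 2 * π * x₀ ^ 2) (hx₀ : 8 ≤ x₀) (hδ : |c - x₀| ≤ 1 / 4)
    (hu : (1 : ℝ) / 2 < |u|) :
    ‖rsKernel (1 / 2 + t * I) (line c u)‖ ≤ 21 / 20 * Real.exp (-(π * |u|)) := by
  obtain ⟨hδ1, hδ2⟩ := abs_le.1 hδ
  have hc : 7.75 ≤ c := by linarith
  have hc0 : 0 < c := by linarith
  rw [norm_rsKernel_half_line hc0, ht]
  have hA : ‖line c u‖ ^ (-(1 / 2 : ℝ)) ≤ 0.428 := by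
    refine rpow_neg_half_le (b := 5.477) (by norm_num) (by norm_num) (by norm_num) ?_
    have h1 := half_sq_le_sq_norm_line c u
    have h2 : (5.477 : ℝ) ^ 2 ≤ ‖line c u‖ ^ 2 := by nlinarith
    nlinarith [norm_nonneg (line c u)]
  have hE : Real.exp (2 * π * x₀ ^ 2 * (line c u).arg + (-2 * π * c * u - 2 * π * u ^ 2)) ≤ 11 / 9 :=
    (Real.exp_le_exp.2 (exponent_le_one_fifth hx₀ hδ hu.le)).trans exp_two_fifths_le.2
  have hS := exp_le_norm_sin_tail c hu.le
  have hexp0 : 0 < Real.exp (π * |u|) := Real.exp_pos _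
  have hnum : ‖line c u‖ ^ (-(1 / 2 : ℝ)) *
      Real.exp (2 * π * x₀ ^ 2 * (line c u).arg + (-2 * π * c * u - 2 * π * u ^ 2)) ≤ 0.428 * (11 / 9) :=
    mul_le_mul hA hE (Real.exp_pos _).le (by norm_num)
  calc _ ≤ 0.428 * (11 / 9) / (2 * ‖Complex.sin (↑π * line c u)‖) :=
        div_le_div_of_nonneg_right hnum (by positivity)
    _ ≤ 0.428 * (11 / 9) / (2 * (Real.exp (π * |u|) / 4)) :=
        div_le_div_of_nonneg_left (by norm_num) (by positivity) (by linarith)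
    _ ≤ 21 / 20 * Real.exp (-(π * |u|)) := by
        rw [Real.exp_neg, div_le_iff₀ (by positivity)]
        field_simp
        nlinarith

/-! ### The integral of `‖F‖` along the saddle line -/

/-- **The saddle-point bound** (Titchmarsh §4.16 / Siegel §2 in crude form): for `t = 2πx₀²`,
`x₀ ≥ 8`, `|c − x₀| ≤ ¼`, `dist(c, ℤ) ≥ ¼`, one has `∫ ‖F_{½+it}(c + u(1+i))‖ du ≤ 3/4`
(core `½·33/50`, middle `2·¼·37/100`, tails `2·(21/20)e^{−π/2}/π`). [cite: Titchmarsh1986, §4.16] -/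
theorem integral_norm_rsKernel_le {x₀ c t : ℝ} (ht : t = 2 * π * x₀ ^ 2) (hx₀ : 8 ≤ x₀)
    (hδ : |c - x₀| ≤ 1 / 4) (hd : ∀ n : ℤ, (1 : ℝ) / 4 ≤ |c - n|) :
    ∫ u : ℝ, ‖rsKernel (1 / 2 + t * I) (line c u)‖ ≤ 3 / 4 := by
  have hπ := Real.pi_pos
  have hπ3 : 3.1415 < π := Real.pi_gt_d4
  obtain ⟨hδ1, hδ2⟩ := abs_le.1 hδ
  have hc0 : 0 < c := by linarith
  set s : ℂ := 1 / 2 + t * I with hs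
  set g : ℝ → ℝ := fun u ↦ ‖rsKernel s (line c u)‖ with hg
  have hgi : Integrable g := (integrable_rsKernel_line s hc0 (by norm_num : (0 : ℝ) < 1 / 4) hd).norm
  have hg0 : ∀ u, 0 ≤ g u := fun u ↦ norm_nonneg _
  -- bounds on the pieces (with `integral_mono_of_nonneg`, no integrability of `g ∘ neg` needed)
  have hmid : ∀ (a b : ℝ) (M : ℝ), a ≤ b → (∀ u ∈ Ioc a b, g u ≤ M) → ∫ u in Ioc a b, g u ≤ M * (b - a) := by
    intro a b M hab hM
    have h1 : ∫ u in Ioc a b, g u ≤ ∫ _ in Ioc a b, M := by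
      refine integral_mono_of_nonneg ?_
        ((continuous_const.integrableOn_Icc (a := a) (b := b)).mono_set Set.Ioc_subset_Icc_self) ?_
      · exact Eventually.of_forall fun u ↦ hg0 u
      · exact (ae_restrict_iff' measurableSet_Ioc).2 (Eventually.of_forall hM)
    rw [setIntegral_const, Real.volume_real_Ioc_of_le hab, smul_eq_mul] at h1
    linarith
  have htail : ∀ f : ℝ → ℝ, (∀ u, 0 ≤ f u) → (∀ u ∈ Ioi (1 / 2 : ℝ), f u ≤ 21 / 20 * Real.exp (-(π * u))) →
      ∫ u in Ioi (1 / 2 : ℝ), f u ≤ 21 / 20 * (Real.exp (-(π * (1 / 2))) / π) := by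
    intro f hf0 hf
    have hexpi : IntegrableOn (fun u : ℝ ↦ 21 / 20 * Real.exp (-π * u)) (Ioi (1 / 2)) :=
      (integrableOn_exp_mul_Ioi (by linarith) _).const_mul _
    have h1 : ∫ u in Ioi (1 / 2 : ℝ), f u ≤ ∫ u in Ioi (1 / 2 : ℝ), 21 / 20 * Real.exp (-π * u) := by
      refine integral_mono_of_nonneg (Eventually.of_forall fun u ↦ hf0 u) hexpi ?_
      refine (ae_restrict_iff' measurableSet_Ioi).2 (Eventually.of_forall fun u hu ↦ ?_)
      show f u ≤ 21 / 20 * Real.exp (-π * u)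
      rw [neg_mul]; exact hf u hu
    rw [MeasureTheory.integral_const_mul, integral_exp_mul_Ioi (by linarith) (1 / 2)] at h1
    rw [neg_mul] at h1
    have e : -Real.exp (-(π * (1 / 2))) / -π = Real.exp (-(π * (1 / 2))) / π := by rw [neg_div_neg_eq]
    rwa [e] at h1
  -- split `ℝ = (-∞,-½] ∪ (-½,-¼] ∪ (-¼,¼] ∪ (¼,½] ∪ (½,∞)`
  have hsplit1 := (intervalIntegral.integral_Iic_add_Ioi (b := -(1 / 2 : ℝ)) hgi.integrableOn hgi.integrableOn).symm
  have hunion : ∀ a b : ℝ, a ≤ b → ∫ u in Ioi a, g u = (∫ u in Ioc a b, g u) + ∫ u in Ioi b, g u := by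
    intro a b hab
    rw [← setIntegral_union Set.Ioc_disjoint_Ioi_same measurableSet_Ioi hgi.integrableOn hgi.integrableOn,
      Set.Ioc_union_Ioi_eq_Ioi hab]
  have hleft : ∫ u in Iic (-(1 / 2 : ℝ)), g u ≤ 21 / 20 * (Real.exp (-(π * (1 / 2))) / π) := by
    rw [← integral_comp_neg_Ioi]  -- `∫_{Iic(-1/2)} g = ∫_{Ioi(1/2)} g(-u)`
    · refine htail (fun u ↦ g (-u)) (fun u ↦ hg0 _) fun u hu ↦ ?_
      have hu0 : (0 : ℝ) < u := by linarith [hu.out]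
      have hu' : (1 : ℝ) / 2 < |(-u)| := by rw [abs_neg, abs_of_pos hu0]; exact hu
      have h := norm_rsKernel_tail (u := -u) ht hx₀ hδ hu'
      rw [abs_neg, abs_of_pos hu0] at h
      exact h
  have hright : ∫ u in Ioi (1 / 2 : ℝ), g u ≤ 21 / 20 * (Real.exp (-(π * (1 / 2))) / π) := by
    refine htail g hg0 fun u hu ↦ ?_
    have hu0 : (0 : ℝ) < u := by linarith [hu.out]
    have hu' : (1 : ℝ) / 2 < |u| := by rw [abs_of_pos hu0]; exact hu
    have h := norm_rsKernel_tail (u := u) ht hx₀ hδ hu'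
    rw [abs_of_pos hu0] at h
    exact h
  have hm1 : ∫ u in Ioc (-(1 / 2 : ℝ)) (-(1 / 4)), g u ≤ 37 / 100 * (-(1 / 4) - -(1 / 2 : ℝ)) :=
    hmid _ _ _ (by norm_num) fun u hu ↦ norm_rsKernel_mid ht hx₀ hδ
      (by rw [abs_of_neg (by linarith [hu.2])]; linarith [hu.2])
      (by rw [abs_of_neg (by linarith [hu.2])]; linarith [hu.1])
  have hm2 : ∫ u in Ioc (-(1 / 4 : ℝ)) (1 / 4), g u ≤ 33 / 50 * (1 / 4 - -(1 / 4 : ℝ)) :=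
    hmid _ _ _ (by norm_num) fun u hu ↦ norm_rsKernel_core ht hx₀ hδ hd (abs_le.2 ⟨hu.1.le, hu.2⟩)
  have hm3 : ∫ u in Ioc ((1 / 4 : ℝ)) (1 / 2), g u ≤ 37 / 100 * (1 / 2 - (1 / 4 : ℝ)) :=
    hmid _ _ _ (by norm_num) fun u hu ↦ norm_rsKernel_mid ht hx₀ hδ
      (by rw [abs_of_pos (by linarith [hu.1])]; exact hu.1.le)
      (by rw [abs_of_pos (by linarith [hu.1])]; exact hu.2)
  -- `e^{-π/2} ≤ 0.2629`
  have hexp : Real.exp (-(π * (1 / 2))) / π ≤ 0.0838 := by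
    have h1 : 3.804 ≤ Real.exp (π * (1 / 2)) := by
      have := Real.quadratic_le_exp_of_nonneg (x := π * (1 / 2)) (by positivity)
      nlinarith
    rw [Real.exp_neg, div_le_iff₀ hπ, inv_eq_one_div, div_le_iff₀ (Real.exp_pos _)]
    nlinarith [mul_le_mul hπ3.le h1 (by norm_num) hπ.le]
  rw [hsplit1, hunion _ _ (by norm_num : (-(1 / 2 : ℝ)) ≤ -(1 / 4)),
    hunion _ _ (by norm_num : (-(1 / 4 : ℝ)) ≤ 1 / 4), hunion _ _ (by norm_num : ((1 / 4 : ℝ)) ≤ 1 / 2)]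
  nlinarith

/-! ### The main sum and the final assembly -/

/-- `Σ_{n=1}^{N} n^{-1/2} ≤ 2√N + 1 − (3/2)√2` for `N ≥ 2` (`1/√(n+1) ≤ 2(√(n+1) − √n)`).
[folklore] -/
lemma sum_rpow_neg_half_le {N : ℕ} (hN : 2 ≤ N) :
    ∑ n ∈ Finset.Icc 1 N, (n : ℝ) ^ (-(1 / 2 : ℝ)) ≤ 2 * Real.sqrt N + 1 - 3 / 2 * Real.sqrt 2 := by
  induction N, hN using Nat.le_induction with
  | base =>
    rw [show Finset.Icc 1 2 = {1, 2} by rfl, Finset.sum_pair (by norm_num)]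
    push_cast
    have h2 : (2 : ℝ) ^ (-(1 / 2 : ℝ)) = Real.sqrt 2 / 2 := by
      rw [Real.rpow_neg (by norm_num : (0 : ℝ) ≤ 2), ← Real.sqrt_eq_rpow,
        inv_eq_one_div, div_eq_div_iff (by positivity) (by norm_num), one_mul,
        Real.mul_self_sqrt (by norm_num)]
    rw [h2, Real.one_rpow]
    linarith
  | succ N hN ih =>
    rw [Finset.sum_Icc_succ_top (by omega), Nat.cast_succ]
    have hN0 : (0 : ℝ) < N := by exact_mod_cast (by omega : 0 < N)
    have hstep : ((N : ℝ) + 1) ^ (-(1 / 2 : ℝ)) ≤ 2 * (Real.sqrt (N + 1) - Real.sqrt N) := by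
      have hs1 : 0 < Real.sqrt (N + 1) := Real.sqrt_pos.2 (by linarith)
      have hs0 : 0 ≤ Real.sqrt N := Real.sqrt_nonneg _
      have hle : Real.sqrt N ≤ Real.sqrt (N + 1) := Real.sqrt_le_sqrt (by linarith)
      have hprod : (Real.sqrt (N + 1) - Real.sqrt N) * (Real.sqrt (N + 1) + Real.sqrt N) = 1 := by
        have hA : Real.sqrt (N + 1) ^ 2 = N + 1 := Real.sq_sqrt (by linarith)
        have hB : Real.sqrt N ^ 2 = N := Real.sq_sqrt hN0.le
        linear_combination hA - hB
      rw [Real.rpow_neg (by linarith), ← Real.sqrt_eq_rpow, inv_eq_one_div, div_le_iff₀ hs1]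
      nlinarith
    linarith

/-- `1.41421 ≤ √2`. [folklore] -/
lemma sqrt_two_ge : (1.41421 : ℝ) ≤ Real.sqrt 2 := by
  rw [Real.le_sqrt (by norm_num) (by norm_num)]; norm_num

/-- The saddle line is clamped to `[N + ¼, N + ¾]` around `x₀`. [folklore] -/
lemma clamp_props {x₀ : ℝ} (hx₀ : 8 ≤ x₀) {N : ℕ} (hN : N = ⌊x₀⌋₊) {c : ℝ}
    (hc : c = max ((N : ℝ) + 1 / 4) (min x₀ (N + 3 / 4))) :
    8 ≤ N ∧ (N : ℝ) + 1 / 4 ≤ c ∧ c ≤ N + 3 / 4 ∧ |c - x₀| ≤ 1 / 4 ∧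
      (∀ n : ℤ, (1 : ℝ) / 4 ≤ |c - n|) ∧ (N : ℝ) ≤ x₀ := by
  have hx0 : 0 ≤ x₀ := by linarith
  have hN8 : 8 ≤ N := by rw [hN]; exact Nat.le_floor (by exact_mod_cast hx₀)
  have hNle : (N : ℝ) ≤ x₀ := by rw [hN]; exact Nat.floor_le hx0
  have hNlt : x₀ < N + 1 := by rw [hN]; exact Nat.lt_floor_add_one x₀
  have hc1 : (N : ℝ) + 1 / 4 ≤ c := by rw [hc]; exact le_max_left _ _
  have hc2 : c ≤ N + 3 / 4 := by rw [hc]; exact max_le (by linarith) (min_le_right _ _)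
  have hc3 : min x₀ ((N : ℝ) + 3 / 4) ≤ c := by rw [hc]; exact le_max_right _ _
  have hc4 : c ≤ max ((N : ℝ) + 1 / 4) x₀ := by
    rw [hc]; exact max_le_max le_rfl (min_le_left _ _)
  refine ⟨hN8, hc1, hc2, ?_, ?_, hNle⟩
  · rw [abs_le]
    constructor
    · rcases min_cases x₀ ((N : ℝ) + 3 / 4) with ⟨h, _⟩ | ⟨h, _⟩ <;> linarith
    · rcases max_cases ((N : ℝ) + 1 / 4) x₀ with ⟨h, _⟩ | ⟨h, _⟩ <;> linarith
  · intro n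
    rcases le_or_gt n N with h | h
    · have : (n : ℝ) ≤ N := by exact_mod_cast h
      rw [abs_of_nonneg (by linarith)]; linarith
    · have : (N : ℝ) + 1 ≤ n := by exact_mod_cast h
      rw [abs_of_nonpos (by linarith)]; linarith

/-- **Lehman's bound** (Trudgian 2011, Lemma 2.5; Lehman 1970, §3): for `t ≥ 128π`,
`|ζ(½ + it)| ≤ 2.53 t^{1/4}`. Proof: `|ζ| ≤ 2|𝓡(s)|` (Riemann–Siegel integral formula on the
critical line), `𝓡(s) = Σ_{n≤N} n^{-s} + J_c(s)` with `N = ⌊√(t/2π)⌋`, `Σ n^{-1/2} ≤ 2√N − 1.12`,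
and the saddle-point bound `|J_c(s)| ≤ √2 · ¾`, whence
`|ζ| ≤ 4√N − 2.24 + 2.13 < 4 (t/2π)^{1/4} ≤ 2.53 t^{1/4}`. This discharges the named fact
`Literature.NumberTheory.LFunctions.Trudgian2011_lemma_2_5`. [cite: Trudgian2011, Lemma 2.5] -/
theorem norm_riemannZeta_half_le_lehman {t : ℝ} (ht : 128 * π ≤ t) :
    ‖riemannZeta (1 / 2 + t * I)‖ ≤ 2.53 * t ^ (1 / 4 : ℝ) := by
  have hπ := Real.pi_pos
  have hπ3 : 3.1415 < π := Real.pi_gt_d4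
  have ht0 : 0 < t := by nlinarith
  -- `x₀ = √(t/2π) ≥ 8`, `t = 2π x₀²`
  set x₀ : ℝ := Real.sqrt (t / (2 * π)) with hx₀def
  have hx₀sq : x₀ ^ 2 = t / (2 * π) := by
    rw [hx₀def]; exact Real.sq_sqrt (div_nonneg ht0.le (by positivity))
  have ht' : t = 2 * π * x₀ ^ 2 := by rw [hx₀sq]; field_simp
  have hx₀ : 8 ≤ x₀ := by
    rw [hx₀def, Real.le_sqrt (by norm_num) (div_nonneg ht0.le (by positivity))]
    rw [le_div_iff₀ (by positivity)]; nlinarith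
  set N : ℕ := ⌊x₀⌋₊ with hNdef
  set c : ℝ := max ((N : ℝ) + 1 / 4) (min x₀ (N + 3 / 4)) with hcdef
  obtain ⟨hN8, hc1, hc2, hδ, hd, hNle⟩ := clamp_props hx₀ hNdef hcdef
  set s : ℂ := 1 / 2 + t * I with hsdef
  -- `|ζ| ≤ 2|𝓡|`, `𝓡 = Σ + J_c`
  have h1 := norm_riemannZeta_half_le_two_mul t
  have h2 := riemannAux_eq_sum_add_rsLineIntegral s (N := N) (by omega) (c := c) (by linarith) (by linarith)
  -- the sum
  have hsum : ‖∑ n ∈ Finset.Icc 1 N, ((n : ℂ)) ^ (-s)‖ ≤ 2 * Real.sqrt N - 1.1213 := by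
    have hN2 : 2 ≤ N := by omega
    calc ‖∑ n ∈ Finset.Icc 1 N, ((n : ℂ)) ^ (-s)‖ ≤ ∑ n ∈ Finset.Icc 1 N, ‖((n : ℂ)) ^ (-s)‖ :=
          norm_sum_le _ _
      _ = ∑ n ∈ Finset.Icc 1 N, (n : ℝ) ^ (-(1 / 2 : ℝ)) := by
          refine Finset.sum_congr rfl fun n hn ↦ ?_
          rw [Complex.norm_natCast_cpow_of_pos (by simp at hn; omega)]
          congr 1
          simp [hsdef]
      _ ≤ 2 * Real.sqrt N + 1 - 3 / 2 * Real.sqrt 2 := sum_rpow_neg_half_le hN2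
      _ ≤ 2 * Real.sqrt N - 1.1213 := by linarith [sqrt_two_ge]
  -- the line integral
  have hJ : ‖rsLineIntegral c s‖ ≤ Real.sqrt 2 * (3 / 4) := by
    rw [rsLineIntegral, norm_mul, norm_neg]
    have hn : ‖(1 : ℂ) + I‖ = Real.sqrt 2 := by
      have := Complex.norm_add_mul_I 1 1
      simp only [ofReal_one, one_mul] at this
      rw [this]; norm_num
    rw [hn]
    refine mul_le_mul_of_nonneg_left ?_ (Real.sqrt_nonneg _)
    refine (norm_integral_le_integral_norm _).trans ?_
    exact integral_norm_rsKernel_le ht' hx₀ hδ hd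
  -- assemble
  have hR : ‖riemannAux s‖ ≤ 2 * Real.sqrt N - 1.1213 + Real.sqrt 2 * (3 / 4) := by
    rw [h2]
    exact (norm_add_le _ _).trans (add_le_add hsum hJ)
  have hsqrtN : Real.sqrt N ≤ Real.sqrt x₀ := Real.sqrt_le_sqrt hNle
  have hsqrt2 : Real.sqrt 2 ≤ 1.4143 := by
    rw [Real.sqrt_le_left (by norm_num)]; norm_num
  -- `4 √x₀ ≤ 2.53 t^{1/4}`: `t^{1/4} = (2π)^{1/4} √x₀` and `(2π)^{1/4} ≥ 1.5811`
  have hfinal : 4 * Real.sqrt x₀ ≤ 2.53 * t ^ (1 / 4 : ℝ) := by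
    have hx0 : 0 ≤ x₀ := by linarith
    have e3 : (1.5811 : ℝ) ≤ (2 * π) ^ (1 / 4 : ℝ) := by
      have h4 : (1.5811 : ℝ) = ((1.5811 : ℝ) ^ 4) ^ ((4 : ℕ)⁻¹ : ℝ) :=
        (Real.pow_rpow_inv_natCast (by norm_num) (by norm_num)).symm
      rw [h4, show ((4 : ℕ)⁻¹ : ℝ) = 1 / 4 by norm_num]
      exact Real.rpow_le_rpow (by positivity) (by nlinarith) (by norm_num)
    have e4 : t ^ (1 / 4 : ℝ) = (2 * π) ^ (1 / 4 : ℝ) * Real.sqrt x₀ := by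
      rw [ht', Real.mul_rpow (by positivity) (by positivity)]
      congr 1
      rw [Real.sqrt_eq_rpow, ← Real.rpow_two, ← Real.rpow_mul hx0]
      norm_num
    rw [e4]
    have hs0 : 0 ≤ Real.sqrt x₀ := Real.sqrt_nonneg _
    nlinarith [mul_le_mul_of_nonneg_right e3 hs0]
  calc ‖riemannZeta (1 / 2 + t * I)‖ ≤ 2 * ‖riemannAux s‖ := h1
    _ ≤ 2 * (2 * Real.sqrt N - 1.1213 + Real.sqrt 2 * (3 / 4)) := by linarith
    _ ≤ 4 * Real.sqrt x₀ := by nlinarith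
    _ ≤ 2.53 * t ^ (1 / 4 : ℝ) := hfinal

end SiegelIntegral

/-- **Discharge of the named fact `Literature.NumberTheory.LFunctions.Trudgian2011_lemma_2_5`**
(Trudgian 2011, Lemma 2.5: "If `t ≥ 128π`, then `|ζ(½+it)| ≤ 2.53 t^{1/4}`"), by Lehman's
argument: the Riemann–Siegel integral formula on the critical line and a saddle-point bound for
Siegel's integral. [cite: Trudgian2011, Lemma 2.5] -/
theorem Trudgian2011_lemma_2_5_holds : Trudgian2011_lemma_2_5 := fun _ ht ↦
  SiegelIntegral.norm_riemannZeta_half_le_lehman ht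

/-- **Discharge of the footnote fact `Literature.NumberTheory.LFunctions.Trudgian2011_lemma_2_5_allT`**
("Lemma 2.5 in fact holds for all `t > 1`"): the certified computation on `1 ≤ t ≤ 404`
(`Trudgian2011_lemma_2_5_smallT`) together with Lehman's bound for `t ≥ 128π`
(`Trudgian2011_lemma_2_5_holds`). [cite: Trudgian2011, Lemma 2.5 (footnote)] -/
theorem Trudgian2011_lemma_2_5_allT_holds : Trudgian2011_lemma_2_5_allT :=
  Trudgian2011_lemma_2_5_allT_of_lemma_2_5 Trudgian2011_lemma_2_5_holds

end Literature.NumberTheory.LFunctions
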